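import Literature.RingTheory.MvPolynomial.KaltofenNoetherFormsNormProofs
import Literature.RingTheory.MvPolynomial.KaltofenNoetherFormsDegreeProofs
import HarnessLib

/-!
# Towards Kaltofen's Theorem 7 (effective Noether forms): proofs — 1-norms of the generic objects

Sibling proof file of `KaltofenNoetherFormsGeneric.lean` (E. Kaltofen, J. Comput. System Sci.
50 (1995) 274–295, §5 proof of Thm. 7, p. 25: "The 1-norm of the generic version of `φ₂`, as a
multivariate polynomial in the `vᵢ`, `wⱼ`, the `c`'s, the `z`'s, `y`, and `x`, is bounded by
`C(d+n, n) 3^d =: A` … Hence we have `‖ρ̄‖₁ ≤ (2d−1)! A^{2d−1}` … and for all `τ ∈ S₃`,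
`‖τ‖₁ ≤ max{‖Δ‖₁} A^D`"). With the nested norms `w₀ = mvNorm |·|` on `ℤ[params]`,
`w_G = mvNorm w₀` on `GenRing n`, `polyNorm w_G`, `polyNorm (polyNorm w_G)` on the univariate /
bivariate polynomials over it, this file proves (with `A' = #exps · 3^d`, `A'' = #exps · 2^d` in
place of Kaltofen's `A`; `#exps ≤ (d+1)^n`):

* `polyNorm_gline_le` (`≤ A''`), `polyNorm_planeGen_le` (`≤ A'`), `wG_bivCoeff_le`, `wG_lam_le`;
* `wG_rhoBar_le` — `‖ρ̄‖ ≤ (2d−1)! (d A'')^{2d−1}`;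
* `wG_clearedEval_le` — `‖λ^D Δ'‖ ≤ (D+1) A'^D ‖Δ‖`;
* `mvNorm_extract_le` — `‖σ‖₁ ≤ ‖ρ̄‖`, `‖τ‖₁ ≤ ‖λ^D Δ'‖` (the forms are sub-sums of coefficients);
* `card_exps_le` — `#exps ≤ (d+1)^n`.

No definitions, no named facts.

## References

* E. Kaltofen, J. Comput. System Sci. 50 (1995) 274–295, §5 proof of Thm. 7 (norm estimates).
  [Kaltofen1995]
-/

noncomputable section

open MvPolynomial
open scoped Polynomial

namespace Literature.RingTheory.MvPolynomial

namespace KaltofenGeneric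

/-! ### The base norm `w₀ = Σ |coeff|` on `ℤ[X_σ]` -/

section Base

variable {σ : Type*}

/-- `w₀(0) = 0`. [folklore] -/
theorem w0_zero : mvNorm Int.natAbs (0 : MvPolynomial σ ℤ) = 0 := mvNorm_zero _

/-- `w₀` is subadditive. [cite: Kaltofen1995, §3 (1-norms)] -/
theorem w0_add_le (p q : MvPolynomial σ ℤ) :
    mvNorm Int.natAbs (p + q) ≤ mvNorm Int.natAbs p + mvNorm Int.natAbs q :=
  mvNorm_add_le _ Int.natAbs_zero (fun a b => Int.natAbs_add_le a b) p q

/-- `w₀` is submultiplicative. [cite: Kaltofen1995, §3 (1-norms)] -/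
theorem w0_mul_le (p q : MvPolynomial σ ℤ) :
    mvNorm Int.natAbs (p * q) ≤ mvNorm Int.natAbs p * mvNorm Int.natAbs q :=
  mvNorm_mul_le _ Int.natAbs_zero (fun a b => Int.natAbs_add_le a b) (fun a b => (Int.natAbs_mul a b).le) p q

/-- `w₀(-p) = w₀(p)`. [folklore] -/
theorem w0_neg (p : MvPolynomial σ ℤ) : mvNorm Int.natAbs (-p) = mvNorm Int.natAbs p :=
  mvNorm_neg _ (fun a => Int.natAbs_neg a) p

/-- `w₀(C c) = |c|`. [folklore] -/
theorem w0_C (c : ℤ) : mvNorm Int.natAbs (C c : MvPolynomial σ ℤ) = c.natAbs := mvNorm_C _ Int.natAbs_zero c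

/-- `w₀(1) = 1`. [folklore] -/
theorem w0_one : mvNorm Int.natAbs (1 : MvPolynomial σ ℤ) = 1 := by rw [← C_1, w0_C]; rfl

/-- `w₀(1) ≤ 1`. [folklore] -/
theorem w0_one_le : mvNorm Int.natAbs (1 : MvPolynomial σ ℤ) ≤ 1 := w0_one.le

/-- `w₀(X i) = 1`. [folklore] -/
theorem w0_X (i : σ) : mvNorm Int.natAbs (X i : MvPolynomial σ ℤ) = 1 := by
  rw [mvNorm_X _ Int.natAbs_zero]; rfl

end Base

/-! ### The norm `w_G = mvNorm w₀` on `GenRing`-like rings `ℤ[X_σ][X_τ]` -/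

section Gen

variable {σ τ : Type*}

/-- `w_G(0) = 0`. [folklore] -/
theorem wG_zero : mvNorm (mvNorm Int.natAbs) (0 : MvPolynomial τ (MvPolynomial σ ℤ)) = 0 := mvNorm_zero _

/-- `w_G` is subadditive. [cite: Kaltofen1995, §3 (1-norms)] -/
theorem wG_add_le (p q : MvPolynomial τ (MvPolynomial σ ℤ)) :
    mvNorm (mvNorm Int.natAbs) (p + q) ≤ mvNorm (mvNorm Int.natAbs) p + mvNorm (mvNorm Int.natAbs) q :=
  mvNorm_add_le _ w0_zero w0_add_le p q

/-- `w_G` is submultiplicative. [cite: Kaltofen1995, §3 (1-norms)] -/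
theorem wG_mul_le (p q : MvPolynomial τ (MvPolynomial σ ℤ)) :
    mvNorm (mvNorm Int.natAbs) (p * q) ≤ mvNorm (mvNorm Int.natAbs) p * mvNorm (mvNorm Int.natAbs) q :=
  mvNorm_mul_le _ w0_zero w0_add_le w0_mul_le p q

/-- `w_G(-p) = w_G(p)`. [folklore] -/
theorem wG_neg (p : MvPolynomial τ (MvPolynomial σ ℤ)) :
    mvNorm (mvNorm Int.natAbs) (-p) = mvNorm (mvNorm Int.natAbs) p := mvNorm_neg _ w0_neg p

/-- `w_G(1) ≤ 1`. [folklore] -/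
theorem wG_one_le : mvNorm (mvNorm Int.natAbs) (1 : MvPolynomial τ (MvPolynomial σ ℤ)) ≤ 1 :=
  mvNorm_one_le _ w0_zero w0_one_le

/-- `w_G(C p) = w₀(p)`. [folklore] -/
theorem wG_C (p : MvPolynomial σ ℤ) : mvNorm (mvNorm Int.natAbs) (C p : MvPolynomial τ (MvPolynomial σ ℤ)) =
    mvNorm Int.natAbs p := mvNorm_C _ w0_zero p

/-- `w_G(X e) = 1`. [folklore] -/
theorem wG_X (e : τ) : mvNorm (mvNorm Int.natAbs) (X e : MvPolynomial τ (MvPolynomial σ ℤ)) = 1 := by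
  rw [mvNorm_X _ w0_zero, w0_one]

/-- `w_G(Σ) ≤ Σ w_G`. [folklore] -/
theorem wG_sum_le {ι : Type*} (s : Finset ι) (p : ι → MvPolynomial τ (MvPolynomial σ ℤ)) :
    mvNorm (mvNorm Int.natAbs) (∑ i ∈ s, p i) ≤ ∑ i ∈ s, mvNorm (mvNorm Int.natAbs) (p i) :=
  mvNorm_sum_le _ w0_zero w0_add_le s p

/-- `w_G(∏) ≤ ∏ w_G`. [folklore] -/
theorem wG_prod_le {ι : Type*} (s : Finset ι) (p : ι → MvPolynomial τ (MvPolynomial σ ℤ)) :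
    mvNorm (mvNorm Int.natAbs) (∏ i ∈ s, p i) ≤ ∏ i ∈ s, mvNorm (mvNorm Int.natAbs) (p i) :=
  mvNorm_prod_le _ w0_zero w0_one_le w0_add_le w0_mul_le s p

/-- `w_G(p^k) ≤ w_G(p)^k`. [folklore] -/
theorem wG_pow_le (p : MvPolynomial τ (MvPolynomial σ ℤ)) (k : ℕ) :
    mvNorm (mvNorm Int.natAbs) (p ^ k) ≤ mvNorm (mvNorm Int.natAbs) p ^ k :=
  mvNorm_pow_le _ w0_zero w0_one_le w0_add_le w0_mul_le p k

/-- An integer constant `C (C c)` has `w_G = |c|`. [folklore] -/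
theorem wG_intCast (c : ℤ) : mvNorm (mvNorm Int.natAbs) (C (C c) : MvPolynomial τ (MvPolynomial σ ℤ)) = c.natAbs := by
  rw [wG_C, w0_C]

end Gen

variable {n d : ℕ}

/-! ### Norms of the parameters and of the generic substitutions -/

/-- `w_G(zᵢ) = 1`. [folklore] -/
theorem wG_zv (i : Fin n) : mvNorm (mvNorm Int.natAbs) (zv n i) = 1 := by rw [zv, wG_C, w0_X]

/-- `w_G(μᵢ) = 1`. [folklore] -/
theorem wG_μv (i : Fin n) : mvNorm (mvNorm Int.natAbs) (μv n i) = 1 := by rw [μv, wG_C, w0_X]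

/-- `w_G(vᵢ) = 1`. [folklore] -/
theorem wG_vv (i : Fin n) : mvNorm (mvNorm Int.natAbs) (vv n i) = 1 := by rw [vv, wG_C, w0_X]

/-- The line factor `μᵢ + vᵢ x` has norm `≤ 2` (Kaltofen counts `3` for `zᵢy + wᵢx + vᵢ`). [cite: Kaltofen1995, §5 proof of Thm. 7 ("the 1-norm of the expanded products … is bounded by 3^d")] -/
theorem polyNorm_lineFactor_le (i : Fin n) :
    polyNorm (mvNorm (mvNorm Int.natAbs)) (Polynomial.C (μv n i) + Polynomial.C (vv n i) * Polynomial.X) ≤ 2 := by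
  refine (polyNorm_add_le _ wG_zero wG_add_le _ _).trans ?_
  rw [polyNorm_C _ wG_zero, wG_μv, ← pow_one (Polynomial.X : Polynomial (GenRing n)),
    polyNorm_C_mul_X_pow _ wG_zero, wG_vv]

/-- The plane factor `μᵢ + vᵢ x + zᵢ y` has norm `≤ 3`. [cite: Kaltofen1995, §5 proof of Thm. 7 ("is bounded by 3^d")] -/
theorem polyNorm_planeFactor_le (i : Fin n) :
    polyNorm (polyNorm (mvNorm (mvNorm Int.natAbs)))
      ((Polynomial.C (Polynomial.C (μv n i)) + Polynomial.C (Polynomial.C (vv n i)) * Polynomial.X +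
        Polynomial.C (Polynomial.C (zv n i) * Polynomial.X) : Polynomial (Polynomial (GenRing n)))) ≤ 3 := by
  have h0P : polyNorm (mvNorm (mvNorm Int.natAbs)) (0 : Polynomial (GenRing n)) = 0 := polyNorm_zero _
  have haddP := polyNorm_add_le (mvNorm (mvNorm Int.natAbs) : GenRing n → ℕ) wG_zero wG_add_le
  refine (polyNorm_add_le _ h0P haddP _ _).trans ?_
  refine (Nat.add_le_add_right (polyNorm_add_le _ h0P haddP _ _) _).trans ?_
  rw [polyNorm_C _ h0P, polyNorm_C _ wG_zero, wG_μv, ← pow_one (Polynomial.X : Polynomial (Polynomial (GenRing n))),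
    polyNorm_C_mul_X_pow _ h0P, polyNorm_C _ wG_zero, wG_vv, polyNorm_C _ h0P,
    ← pow_one (Polynomial.X : Polynomial (GenRing n)), polyNorm_C_mul_X_pow _ wG_zero, wG_zv]

/-- Exponents in `exps n d` have degree `≤ d`, coordinatewise too. [folklore] -/
theorem sum_le_of_mem_exps {e : Fin n →₀ ℕ} (he : e ∈ exps n d) : ∑ i, e i ≤ d := by
  rw [mem_exps] at he
  rwa [← Finsupp.sum_fintype e (fun _ k => k) fun _ => rfl]

/-- **`‖g‖ ≤ #exps · 2^d`** for the generic line section. [cite: Kaltofen1995, §5 proof of Thm. 7 (norm of the generic substitution)] -/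
theorem polyNorm_gline_le :
    polyNorm (mvNorm (mvNorm Int.natAbs)) (gline n d) ≤ (exps n d).card * 2 ^ d := by
  classical
  have hnorm1 : polyNorm (mvNorm (mvNorm Int.natAbs)) (1 : Polynomial (GenRing n)) ≤ 1 :=
    polyNorm_one_le _ wG_zero wG_one_le
  have hmulP := polyNorm_mul_le (mvNorm (mvNorm Int.natAbs) : GenRing n → ℕ) wG_zero wG_add_le wG_mul_le
  rw [gline, aeval_fgen_eq_sum]
  refine (polyNorm_sum_le _ wG_zero wG_add_le _ _).trans ?_
  rw [Finset.card_eq_sum_ones, Finset.sum_mul]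
  refine Finset.sum_le_sum fun e he => ?_
  rw [one_mul]
  refine (hmulP _ _).trans ?_
  rw [Polynomial.algebraMap_apply, Algebra.algebraMap_self_apply, polyNorm_C _ wG_zero, wG_X, one_mul]
  refine (polyNorm_prod_le _ wG_zero wG_one_le wG_add_le wG_mul_le _ _).trans ?_
  calc ∏ i, polyNorm (mvNorm (mvNorm Int.natAbs)) ((Polynomial.C (μv n i) + Polynomial.C (vv n i) * Polynomial.X) ^ e i)
      ≤ ∏ i, 2 ^ e i := by
        refine Finset.prod_le_prod (fun i _ => Nat.zero_le _) fun i _ => ?_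
        exact (polyNorm_pow_le _ wG_zero wG_one_le wG_add_le wG_mul_le _ _).trans
          (Nat.pow_le_pow_left (polyNorm_lineFactor_le i) _)
    _ = 2 ^ ∑ i, e i := (Finset.prod_pow_eq_pow_sum _ _ _)
    _ ≤ 2 ^ d := Nat.pow_le_pow_right (by norm_num) (sum_le_of_mem_exps he)

/-- **`‖φ₂‖ ≤ #exps · 3^d`** for the generic plane section (Kaltofen's `A`). [cite: Kaltofen1995, §5 proof of Thm. 7 ("bounded by C(d+n,n)3^d =: A")] -/
theorem polyNorm_planeGen_le :
    polyNorm (polyNorm (mvNorm (mvNorm Int.natAbs))) (planeGen n d) ≤ (exps n d).card * 3 ^ d := by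
  classical
  have h0P : polyNorm (mvNorm (mvNorm Int.natAbs)) (0 : Polynomial (GenRing n)) = 0 := polyNorm_zero _
  have haddP := polyNorm_add_le (mvNorm (mvNorm Int.natAbs) : GenRing n → ℕ) wG_zero wG_add_le
  have hmulP := polyNorm_mul_le (mvNorm (mvNorm Int.natAbs) : GenRing n → ℕ) wG_zero wG_add_le wG_mul_le
  have h1P : polyNorm (mvNorm (mvNorm Int.natAbs)) (1 : Polynomial (GenRing n)) ≤ 1 :=
    polyNorm_one_le _ wG_zero wG_one_le
  rw [planeGen, aeval_fgen_eq_sum]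
  refine (polyNorm_sum_le _ h0P haddP _ _).trans ?_
  rw [Finset.card_eq_sum_ones, Finset.sum_mul]
  refine Finset.sum_le_sum fun e he => ?_
  rw [one_mul]
  refine (polyNorm_mul_le _ h0P haddP hmulP _ _).trans ?_
  rw [Polynomial.algebraMap_apply, Polynomial.algebraMap_apply, Algebra.algebraMap_self_apply, polyNorm_C _ h0P,
    polyNorm_C _ wG_zero, wG_X, one_mul]
  refine (polyNorm_prod_le _ h0P h1P haddP hmulP _ _).trans ?_
  calc ∏ i, polyNorm (polyNorm (mvNorm (mvNorm Int.natAbs)))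
        (((Polynomial.C (Polynomial.C (μv n i)) + Polynomial.C (Polynomial.C (vv n i)) * Polynomial.X +
          Polynomial.C (Polynomial.C (zv n i) * Polynomial.X) : Polynomial (Polynomial (GenRing n)))) ^ e i)
      ≤ ∏ i, 3 ^ e i := by
        refine Finset.prod_le_prod (fun i _ => Nat.zero_le _) fun i _ => ?_
        exact (polyNorm_pow_le _ h0P h1P haddP hmulP _ _).trans (Nat.pow_le_pow_left (polyNorm_planeFactor_le i) _)
    _ = 3 ^ ∑ i, e i := (Finset.prod_pow_eq_pow_sum _ _ _)
    _ ≤ 3 ^ d := Nat.pow_le_pow_right (by norm_num) (sum_le_of_mem_exps he)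

/-- **`‖N_b‖ ≤ #exps · 3^d`**: each coefficient of `φ₂` is bounded by its total norm. [cite: Kaltofen1995, §5 proof of Thm. 7] -/
theorem wG_bivCoeff_le (b : ℕ × ℕ) : mvNorm (mvNorm Int.natAbs) (bivCoeff n d b) ≤ (exps n d).card * 3 ^ d := by
  rw [bivCoeff]
  refine le_trans ?_ polyNorm_planeGen_le
  refine (norm_coeff_le_polyNorm _ wG_zero _ _).trans ?_
  exact norm_coeff_le_polyNorm _ (polyNorm_zero _) _ _

/-- **`‖λ‖ ≤ #topExps`**. [cite: Kaltofen1995, §5 proof of Thm. 7] -/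
theorem wG_lam_le : mvNorm (mvNorm Int.natAbs) (lam n d) ≤ (topExps n d).card := by
  classical
  rw [lam]
  refine (wG_sum_le _ _).trans ?_
  rw [Finset.card_eq_sum_ones]
  refine Finset.sum_le_sum fun e _ => ?_
  refine (wG_mul_le _ _).trans ?_
  rw [wG_X, one_mul]
  refine (wG_prod_le _ _).trans ?_
  calc ∏ i, mvNorm (mvNorm Int.natAbs) (vv n i ^ e i) ≤ ∏ _i : Fin n, (1 : ℕ) :=
        Finset.prod_le_prod (fun i _ => Nat.zero_le _) fun i _ => by
          refine (wG_pow_le _ _).trans ?_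
          rw [wG_vv, one_pow]
    _ = 1 := Finset.prod_const_one

/-! ### `‖ρ̄‖ ≤ (2d−1)! (d A'')^{2d−1}` -/

/-- The generic line section has `x`-degree `≤ d`. [folklore] -/
theorem natDegree_gline_le : (gline n d).natDegree ≤ d := by
  classical
  rw [gline, aeval_fgen_eq_sum]
  refine Polynomial.natDegree_sum_le_of_forall_le _ _ fun e he => ?_
  rw [Polynomial.algebraMap_apply, Algebra.algebraMap_self_apply]
  refine (Polynomial.natDegree_C_mul_le _ _).trans ?_
  refine (Polynomial.natDegree_prod_le _ _).trans ?_
  have hθ : ∀ i : Fin n, (Polynomial.C (μv n i) + Polynomial.C (vv n i) * Polynomial.X : Polynomial (GenRing n)).natDegree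
      ≤ 1 := fun i =>
    (Polynomial.natDegree_add_le _ _).trans (max_le (by rw [Polynomial.natDegree_C]; exact Nat.zero_le _)
      ((Polynomial.natDegree_C_mul_le _ _).trans Polynomial.natDegree_X_le))
  calc ∑ i, ((Polynomial.C (μv n i) + Polynomial.C (vv n i) * Polynomial.X) ^ e i).natDegree
      ≤ ∑ i, e i * 1 :=
        Finset.sum_le_sum (f := fun i => ((Polynomial.C (μv n i) + Polynomial.C (vv n i) * Polynomial.X) ^ e i).natDegree)
          (g := fun i => e i * 1) fun i _ => Polynomial.natDegree_pow_le.trans (Nat.mul_le_mul_left (e i) (hθ i))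
    _ = ∑ i, e i := by simp
    _ ≤ d := sum_le_of_mem_exps he

/-- **`‖ρ̄‖ ≤ (2d−1)! (d·#exps·2^d)^{2d−1}`** (Kaltofen: "`‖ρ̄‖₁ ≤ (2d−1)! A^{2d−1}`"): Leibniz
expansion of the Sylvester determinant, whose entries are coefficients of `g` or `∂g/∂x`.
[cite: Kaltofen1995, §5 proof of Thm. 7] -/
theorem wG_rhoBar_le (hd : 1 ≤ d) :
    mvNorm (mvNorm Int.natAbs) (rhoBar n d) ≤
      (d + (d - 1)).factorial * (d * ((exps n d).card * 2 ^ d)) ^ (d + (d - 1)) := by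
  rw [rhoBar, Polynomial.resultant]
  have hW : ∀ i j, mvNorm (mvNorm Int.natAbs)
      (Polynomial.sylvester (gline n d) (Polynomial.derivative (gline n d)) d (d - 1) i j) ≤
        d * ((exps n d).card * 2 ^ d) := by
    refine forall_sylvester (fun x : GenRing n => mvNorm (mvNorm Int.natAbs) x ≤ d * ((exps n d).card * 2 ^ d))
      (by rw [wG_zero]; exact Nat.zero_le _) _ _ _ _ (fun i => ?_) (fun i => ?_)
    · calc mvNorm (mvNorm Int.natAbs) ((gline n d).coeff i)
          ≤ polyNorm (mvNorm (mvNorm Int.natAbs)) (gline n d) := norm_coeff_le_polyNorm _ wG_zero _ _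
        _ ≤ (exps n d).card * 2 ^ d := polyNorm_gline_le
        _ ≤ d * ((exps n d).card * 2 ^ d) := Nat.le_mul_of_pos_left _ hd
    · calc mvNorm (mvNorm Int.natAbs) ((Polynomial.derivative (gline n d)).coeff i)
          ≤ polyNorm (mvNorm (mvNorm Int.natAbs)) (Polynomial.derivative (gline n d)) :=
            norm_coeff_le_polyNorm _ wG_zero _ _
        _ ≤ (gline n d).natDegree * polyNorm (mvNorm (mvNorm Int.natAbs)) (gline n d) :=
            polyNorm_derivative_le _ wG_zero wG_add_le _
        _ ≤ d * ((exps n d).card * 2 ^ d) := Nat.mul_le_mul natDegree_gline_le polyNorm_gline_le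
  have h := norm_det_le_factorial_mul_pow (mvNorm (mvNorm Int.natAbs)) wG_zero wG_one_le wG_add_le wG_mul_le
    wG_neg (Polynomial.sylvester (gline n d) (Polynomial.derivative (gline n d)) d (d - 1)) hW
  rwa [Fintype.card_fin] at h

/-! ### `‖λ^D Δ'‖ ≤ (D+1) A'^D ‖Δ‖` -/

/-- **Norm of an evaluation:** `‖p(N)‖ ≤ ‖p‖₁ A^k` for `p` homogeneous of degree `k` with integer
coefficients and `‖N_b‖ ≤ A`. [cite: Kaltofen1995, §5 proof of Thm. 7 ("‖τ‖₁ ≤ max{‖Δ‖₁} A^D")] -/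
theorem wG_aeval_le {τ : Type*} (N : τ → GenRing n) {A : ℕ} (hN : ∀ b, mvNorm (mvNorm Int.natAbs) (N b) ≤ A)
    {p : MvPolynomial τ ℤ} {k : ℕ} (hp : p.IsHomogeneous k) :
    mvNorm (mvNorm Int.natAbs) (MvPolynomial.aeval N p) ≤ mvNorm Int.natAbs p * A ^ k := by
  classical
  conv_lhs => rw [p.as_sum]
  rw [map_sum]
  refine (wG_sum_le _ _).trans ?_
  rw [mvNorm, Finset.sum_mul]
  refine Finset.sum_le_sum fun m hm => ?_
  rw [aeval_monomial, show algebraMap ℤ (GenRing n) (coeff m p) = C (C (coeff m p)) from rfl]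
  refine (wG_mul_le _ _).trans ?_
  rw [wG_intCast]
  refine Nat.mul_le_mul_left _ ?_
  have hdeg : m.degree = k := by
    rw [Finsupp.degree_eq_weight_one]; exact hp (mem_support_iff.1 hm)
  rw [Finsupp.prod]
  refine (wG_prod_le _ _).trans ?_
  calc ∏ b ∈ m.support, mvNorm (mvNorm Int.natAbs) (N b ^ m b) ≤ ∏ b ∈ m.support, A ^ m b :=
        Finset.prod_le_prod (fun _ _ => Nat.zero_le _) fun b _ =>
          (wG_pow_le _ _).trans (Nat.pow_le_pow_left (hN b) _)
    _ = A ^ ∑ b ∈ m.support, m b := Finset.prod_pow_eq_pow_sum _ _ _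
    _ = A ^ k := by rw [← hdeg, Finsupp.degree_apply]

/-- A homogeneous component has norm at most that of the polynomial. [folklore] -/
theorem mvNorm_homogeneousComponent_le {τ : Type*} (p : MvPolynomial τ ℤ) (k : ℕ) :
    mvNorm Int.natAbs (homogeneousComponent k p) ≤ mvNorm Int.natAbs p := by
  classical
  have hcoeff : ∀ m ∈ (homogeneousComponent k p).support, coeff m (homogeneousComponent k p) = coeff m p := by
    intro m hm
    rw [mem_support_iff, coeff_homogeneousComponent] at hm
    rw [coeff_homogeneousComponent]
    split_ifs with h
    · rfl
    · simp [h] at hm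
  have hsub : (homogeneousComponent k p).support ⊆ p.support := by
    intro m hm
    have h := hcoeff m hm
    rw [mem_support_iff] at hm ⊢
    rwa [h] at hm
  unfold mvNorm
  calc ∑ m ∈ (homogeneousComponent k p).support, (coeff m (homogeneousComponent k p)).natAbs
      = ∑ m ∈ (homogeneousComponent k p).support, (coeff m p).natAbs :=
        Finset.sum_congr rfl fun m hm => by rw [hcoeff m hm]
    _ ≤ ∑ m ∈ p.support, (coeff m p).natAbs :=
        Finset.sum_le_sum_of_subset_of_nonneg hsub fun _ _ _ => Nat.zero_le _

/-- **`‖λ^D Δ'‖ ≤ (D+1) (#exps·3^d)^D ‖Δ‖₁`** (Kaltofen: "`‖τ‖₁ ≤ max{‖Δ‖₁} A^D`", up to the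
factor `D+1` from summing the homogeneous components). [cite: Kaltofen1995, §5 proof of Thm. 7] -/
theorem wG_clearedEval_le (D : ℕ) (Δ : MvPolynomial (ℕ × ℕ) ℤ) :
    mvNorm (mvNorm Int.natAbs) (clearedEval n d D Δ) ≤
      (D + 1) * ((exps n d).card * 3 ^ d) ^ D * mvNorm Int.natAbs Δ := by
  set A := (exps n d).card * 3 ^ d with hA
  have hlam : mvNorm (mvNorm Int.natAbs) (lam n d) ≤ A := by
    refine wG_lam_le.trans ((Finset.card_le_card topExps_subset_exps).trans ?_)
    exact Nat.le_mul_of_pos_right _ (pow_pos (by norm_num) _)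
  rw [clearedEval]
  refine (wG_sum_le _ _).trans ?_
  calc ∑ k ∈ Finset.range (D + 1), mvNorm (mvNorm Int.natAbs)
        (lam n d ^ (D - k) * MvPolynomial.aeval (bivCoeff n d) (homogeneousComponent k Δ))
      ≤ ∑ _k ∈ Finset.range (D + 1), A ^ D * mvNorm Int.natAbs Δ := by
        refine Finset.sum_le_sum fun k hk => ?_
        rw [Finset.mem_range] at hk
        refine (wG_mul_le _ _).trans ?_
        calc mvNorm (mvNorm Int.natAbs) (lam n d ^ (D - k)) *
              mvNorm (mvNorm Int.natAbs) (MvPolynomial.aeval (bivCoeff n d) (homogeneousComponent k Δ))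
            ≤ A ^ (D - k) * (mvNorm Int.natAbs (homogeneousComponent k Δ) * A ^ k) :=
              Nat.mul_le_mul ((wG_pow_le _ _).trans (Nat.pow_le_pow_left hlam _))
                (wG_aeval_le _ wG_bivCoeff_le (homogeneousComponent_isHomogeneous k Δ))
          _ ≤ A ^ (D - k) * (mvNorm Int.natAbs Δ * A ^ k) :=
              Nat.mul_le_mul_left _ (Nat.mul_le_mul_right _ (mvNorm_homogeneousComponent_le Δ k))
          _ = A ^ D * mvNorm Int.natAbs Δ := by
              rw [mul_comm (mvNorm _ Δ), ← mul_assoc, ← pow_add, Nat.sub_add_cancel (by omega)]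
    _ = (D + 1) * A ^ D * mvNorm Int.natAbs Δ := by
        rw [Finset.sum_const, Finset.card_range, smul_eq_mul, mul_assoc]

/-! ### The forms are sub-sums of coefficients: `‖σ‖₁ ≤ ‖ρ̄‖`, `‖τ‖₁ ≤ ‖λ^D Δ'‖` -/

/-- **`‖extract F m‖₁ ≤ ‖F‖`**: the 1-norm (`= l1Norm = weight = mvNorm |·|`) of an extracted
form is at most the nested norm of `F`. [cite: Kaltofen1995, §5 proof of Thm. 7 ("kρ̄k₁ ≤ … ⟹ kσk₁ ≤ …")] -/
theorem mvNorm_extract_le (F : GenRing n) (m : Params n →₀ ℕ) :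
    mvNorm Int.natAbs (extract F m) ≤ mvNorm (mvNorm Int.natAbs) F := by
  classical
  have hsub : (extract F m).support ⊆ F.support := by
    intro e he
    rw [mem_support_iff, coeff_extract] at he
    rw [mem_support_iff]
    intro h0
    apply he
    rw [h0, coeff_zero]
  change (∑ e ∈ (extract F m).support, (coeff e (extract F m)).natAbs) ≤
    ∑ e ∈ F.support, mvNorm Int.natAbs (coeff e F)
  calc ∑ e ∈ (extract F m).support, (coeff e (extract F m)).natAbs
      = ∑ e ∈ (extract F m).support, (coeff m (coeff e F)).natAbs :=
        Finset.sum_congr rfl fun e _ => by rw [coeff_extract]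
    _ ≤ ∑ e ∈ (extract F m).support, mvNorm Int.natAbs (coeff e F) :=
        Finset.sum_le_sum fun e _ => norm_coeff_le_mvNorm _ Int.natAbs_zero _ _
    _ ≤ ∑ e ∈ F.support, mvNorm Int.natAbs (coeff e F) :=
        Finset.sum_le_sum_of_subset_of_nonneg hsub fun _ _ _ => Nat.zero_le _

/-! ### `#exps ≤ (d+1)^n` -/

/-- Coordinates of an exponent of degree `≤ d` are `≤ d`. [folklore] -/
theorem apply_le_of_mem_exps {e : Fin n →₀ ℕ} (he : e ∈ exps n d) (i : Fin n) : e i ≤ d :=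
  (Finset.single_le_sum (f := fun j => e j) (fun _ _ => Nat.zero_le _) (Finset.mem_univ i)).trans (sum_le_of_mem_exps he)

/-- **`#exps ≤ (d+1)^n`** (each coordinate is at most `d`; Kaltofen uses the exact count
`C(d+n, n) ≤ 2^{d+n}`). [folklore] -/
theorem card_exps_le : (exps n d).card ≤ (d + 1) ^ n := by
  classical
  have h := Finset.card_le_card_of_injOn (s := exps n d) (t := (Finset.univ : Finset (Fin n → Fin (d + 1))))
    (fun e i => (⟨min (e i) d, by omega⟩ : Fin (d + 1))) (fun e _ => Finset.mem_univ _) ?_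
  · simpa [Finset.card_univ, Fintype.card_fin] using h
  · intro e₁ he₁ e₂ he₂ heq
    ext i
    have h1 := apply_le_of_mem_exps he₁ i
    have h2 := apply_le_of_mem_exps he₂ i
    have := congrFun heq i
    simp only [Fin.mk.injEq] at this
    rwa [min_eq_left h1, min_eq_left h2] at this

end KaltofenGeneric

end Literature.RingTheory.MvPolynomial

end
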